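import Mathlib
import HarnessLib
import Summits.HubbardSuperconductivity.HubbardSuperconductivity.Theorems.KLProgrammeC4aPPKernelFarSFlatnessIdentity
import Summits.HubbardSuperconductivity.HubbardSuperconductivity.Theorems.KLProgrammeC4aPPKernelMidFlatness

/-!
# Route `KLProgramme` — crux C4a, S3 brick (B4) «(B4)-UMK1», «(U1)-FARS-ROWS» part 4: pointwise sizes for the FLATNESS of the smooth far piece along the
# anti-diagonal — alive/dead geometry (`e < t₁D` alive, dead beyond), and the defect integrand's majorants near (`e ≤ Λ`) and far (`e > Λ`) for `D ≥ 2Λ`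

Cell `gate-hubbard-kl`, seat hubbard-kl-k3c3-p1 (g17; row «δμ-flow with klAngularMean constant piece»).  Inputs of the `hflat` row of `foldBox_law_rows'` for
`ppFarKernelS` (part 5 integrates them with `farFlatness_integral_identity`): with `R(e) = E_N·κ(r) + N·κ′(r)·ρ` the defect integrand of part 3,
* §1 `farS_antidiag_dead` (`t₁D ≤ e ⟹ κ(r) = κ′(r) = 0` at `(e, D−e)`), `farS_antidiag_alive` (alive ⟹ `e < t₁D`, `(1−t₁)D ≤ D−e`);
* §2 the two halves of `R` separately (part 5 `…FarSFlatnessRow` adds them): `abs_farEuler_near_le` (`e ≤ Λ`, `2Λ ≤ D`: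
  `|E_N·κ(r)| ≤ κ₀((6B₁+5/2) + β|D−e|e^{−β|D−e|} + Λ/((1−t₁)D))`), `abs_farEuler_far_le` (`Λ < e`, `2Λ ≤ D`: `|E_N·κ(r)| ≤ κ₀(βe·e^{−βe} + β|D−e|e^{−β|D−e|})`),
  `abs_farFloorDefect_le` (`|N·κ′(r)·ρ| ≤ κ₁·lo/((1−t₁)D)`), `abs_mul_sech_sq_le`, `farDefect_eq_zero_of_ge` (`t₁D ≤ e ⟹ R = 0`), `abs_farPhi_le` (`|Φ(x)| ≤ |x|κ₀`),
  `farPhi_eq_zero_of_ge` (`t₁D ≤ x ⟹ Φ(x) = 0`).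
Pure real analysis; nothing asserts (C), K3, the window or superconductivity.
References: BGM 2006 §2.1 (2.2)–(2.5), §2.4 (2.36) [cite: BenfattoGiulianiMastropietro2006]; FST II CPAM 51 (1998) §3 [cite: FeldmanSalmhoferTrubowitz1998].
-/

noncomputable section

namespace Summit.HubbardSuperconductivity.HubbardSuperconductivity.Theorems.C4a

set_option linter.dupNamespace false -- summit = problem name (single-conjunct summit), D-0017

open Real Filter Set MeasureTheory intervalIntegral
open scoped Topology Interval
open Literature.MathematicalPhysics.QuantumLattice Literature.Analysis.SpecialFunctions

section Flat

variable {β Λ : ℝ} (hβ : 0 < β) (hΛ : 0 < Λ) {B₁ : ℝ} (hB₁ : ∀ x, |deriv salmhoferCutoff x| ≤ B₁)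
  {κ κ' κ'' : ℝ → ℝ} {κ₀ κ₁ : ℝ} (hκb : ∀ t ∈ Icc 0 1, |κ t| ≤ κ₀) (hκ'b : ∀ t ∈ Icc 0 1, |κ' t| ≤ κ₁)
  {t₁ : ℝ} (ht₀ : 0 < t₁) (ht25 : t₁ ≤ 2 / 5)
  (hκs : ∀ t, t₁ ≤ t → κ t = 0) (hκ's : ∀ t, t₁ ≤ t → κ' t = 0) (hκ''s : ∀ t, t₁ ≤ t → κ'' t = 0)
  {lo : ℝ} (hlo : 0 < lo) (hloΛ : lo ≤ Λ)

/-! ## §1 Alive and dead along the anti-diagonal -/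

include ht₀ ht25 hκs hκ's hκ''s hlo in
/-- **Dead beyond `t₁D`**: `0 < e`, `t₁D ≤ e` ⟹ `κ(r(e,D−e)) = 0 ∧ κ′(r(e,D−e)) = 0` (`|D−e| ≤ q_s·e`). [folklore] -/
theorem farS_antidiag_dead {D e : ℝ} (hD : 0 ≤ D) (he : 0 < e) (hge : t₁ * D ≤ e) :
    κ (ppSmoothRatio lo e (D - e)) = 0 ∧ κ' (ppSmoothRatio lo e (D - e)) = 0 := by
  have hqs : 1 ≤ (1 - t₁) / t₁ := by rw [le_div_iff₀ ht₀]; linarith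
  have hQ : (1 - t₁) / t₁ * e = e / t₁ - e := by field_simp
  have hD' : D ≤ e / t₁ := by rw [le_div_iff₀ ht₀]; linarith
  have hQe : e ≤ (1 - t₁) / t₁ * e := le_mul_of_one_le_left he.le hqs
  have habs : |D - e| ≤ (1 - t₁) / t₁ * |e| := by
    rw [abs_of_pos he, abs_le]
    constructor
    · linarith
    · rw [hQ]; linarith
  obtain ⟨h0, h1, -⟩ := farS_dead_of_scale_le ht₀ hκs hκ's hκ''s hlo (ppSmoothScale_le_mul hqs habs)
  exact ⟨h0, h1⟩

include ht₀ ht25 hlo in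
/-- **Alive ⟹ `e < t₁D`, `(1−t₁)D ≤ D − e`, `0 < D − e`** (`0 < e`, `((1−t₁)/t₁)·m̃ₑ < m̃_{D−e}`). [folklore] -/
theorem farS_antidiag_alive {D e : ℝ} (hD : 0 < D) (he : 0 < e) (halive : (1 - t₁) / t₁ * ppSmoothScale lo e < ppSmoothScale lo (D - e)) :
    e < t₁ * D ∧ (1 - t₁) * D ≤ D - e ∧ 0 < D - e := by
  set qs : ℝ := (1 - t₁) / t₁ with hqsdef
  have hqs : 3 / 2 ≤ qs := by rw [hqsdef, le_div_iff₀ ht₀]; linarith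
  have h1 : 0 ≤ ppSmoothScale lo e := (ppSmoothScale_pos hlo e).le
  have hsq : qs ^ 2 * (e ^ 2 + lo ^ 2) < (D - e) ^ 2 + lo ^ 2 := by
    have := mul_self_lt_mul_self (by positivity) halive
    rw [← sq, ← sq, mul_pow, ppSmoothScale_sq, ppSmoothScale_sq] at this
    exact this
  have hq1 : 1 ≤ qs ^ 2 := by nlinarith
  have hu2 : (qs * e) ^ 2 < (D - e) ^ 2 := by nlinarith [mul_le_mul_of_nonneg_left hq1 (sq_nonneg lo)]
  have hu : qs * e < |D - e| := by
    have := sq_lt_sq.1 hu2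
    rwa [abs_of_pos (by positivity : 0 < qs * e)] at this
  have hpos : 0 < D - e := by
    by_contra hn
    rw [not_lt] at hn
    rw [abs_of_nonpos hn] at hu
    nlinarith
  rw [abs_of_pos hpos] at hu
  have hprod : (qs + 1) * t₁ = 1 := by rw [hqsdef]; field_simp; ring
  refine ⟨by nlinarith, by nlinarith, hpos⟩

/-! ## §2 Sizes of the defect integrand and of the boundary function -/

include hκb hlo in
/-- `|Φ(x)| = |x·N(x,D−x)·κ(r)| ≤ |x|·κ₀`. [folklore] -/
theorem abs_farPhi_le (hβ : 0 < β) (D x : ℝ) : |x * ppTrueNumerator β Λ x (D - x) * κ (ppSmoothRatio lo x (D - x))| ≤ |x| * κ₀ := by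
  have hr := ppSmoothRatio_mem_Ioo hlo x (D - x)
  rw [abs_mul, abs_mul]
  calc |x| * |ppTrueNumerator β Λ x (D - x)| * |κ (ppSmoothRatio lo x (D - x))| ≤ |x| * 1 * κ₀ := by
        gcongr
        · exact abs_ppTrueNumerator_le_one hβ Λ x (D - x)
        · exact hκb _ ⟨hr.1.le, hr.2.le⟩
    _ = |x| * κ₀ := by ring

include ht₀ ht25 hκs hκ's hκ''s hlo in
/-- `t₁D ≤ x`, `0 < x` ⟹ `Φ(x) = 0`. [folklore] -/
theorem farPhi_eq_zero_of_ge {β D x : ℝ} (hD : 0 ≤ D) (hx : 0 < x) (hge : t₁ * D ≤ x) :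
    x * ppTrueNumerator β Λ x (D - x) * κ (ppSmoothRatio lo x (D - x)) = 0 := by
  rw [(farS_antidiag_dead ht₀ ht25 hκs hκ's hκ''s hlo hD hx hge).1, mul_zero]

include ht₀ ht25 hκs hκ's hκ''s hlo in
/-- `t₁D ≤ e`, `0 < e` ⟹ the defect integrand vanishes. [folklore] -/
theorem farDefect_eq_zero_of_ge {β D e : ℝ} (hD : 0 ≤ D) (he : 0 < e) (hge : t₁ * D ≤ e) :
    (e * ppTrueNumeratorDu β Λ (D - e) e + (D - e) * ppTrueNumeratorDu β Λ e (D - e)) * κ (ppSmoothRatio lo e (D - e)) +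
        ppTrueNumerator β Λ e (D - e) * κ' (ppSmoothRatio lo e (D - e)) *
          (lo ^ 2 * (e ^ 2 - (D - e) ^ 2) / (ppSmoothScale lo e * ppSmoothScale lo (D - e) * (ppSmoothScale lo e + ppSmoothScale lo (D - e)) ^ 2)) = 0 := by
  obtain ⟨h0, h1⟩ := farS_antidiag_dead ht₀ ht25 hκs hκ's hκ''s hlo hD he hge
  rw [h0, h1]; ring

/-- `|x|·(β/4)sech²(βx/2) ≤ β|x|·e^{−β|x|}`. [folklore] -/
theorem abs_mul_sech_sq_le {β : ℝ} (hβ : 0 < β) (x : ℝ) : |x * (β / 4 * sech (β * x / 2) ^ 2)| ≤ β * |x| * Real.exp (-(β * |x|)) := by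
  have hs : sech (β * x / 2) ^ 2 = sech (β * |x| / 2) ^ 2 := by
    rcases le_or_gt 0 x with h | h
    · rw [abs_of_nonneg h]
    · rw [abs_of_neg h, show β * -x / 2 = -(β * x / 2) by ring, sech_neg]
  have hb := sech_half_sq_le_four_exp_neg (show 0 ≤ β * |x| by positivity)
  rw [abs_mul, hs, abs_of_nonneg (by positivity : (0 : ℝ) ≤ β / 4 * sech (β * |x| / 2) ^ 2)]
  calc |x| * (β / 4 * sech (β * |x| / 2) ^ 2) ≤ |x| * (β / 4 * (4 * Real.exp (-(β * |x|)))) := by gcongr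
    _ = β * |x| * Real.exp (-(β * |x|)) := by ring

include hβ hκ'b ht₀ ht25 hκs hκ's hκ''s hlo in
/-- The floor-defect term on the alive anti-diagonal: `|N·κ′(r)·ρ| ≤ κ₁·lo/((1−t₁)D)` (`0 < e`; off the alive zone it vanishes). [folklore] -/
theorem abs_farFloorDefect_le {D e : ℝ} (hD : 0 < D) (he : 0 < e) :
    |ppTrueNumerator β Λ e (D - e) * κ' (ppSmoothRatio lo e (D - e)) *
        (lo ^ 2 * (e ^ 2 - (D - e) ^ 2) / (ppSmoothScale lo e * ppSmoothScale lo (D - e) * (ppSmoothScale lo e + ppSmoothScale lo (D - e)) ^ 2))| ≤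
      κ₁ * (lo / ((1 - t₁) * D)) := by
  have hκ₁ : 0 ≤ κ₁ := (abs_nonneg _).trans (hκ'b 0 (left_mem_Icc.2 zero_le_one))
  have ht1 : 0 < 1 - t₁ := by linarith
  rcases le_or_gt (ppSmoothScale lo (D - e)) ((1 - t₁) / t₁ * ppSmoothScale lo e) with hdead | halive
  · obtain ⟨-, h1, -⟩ := farS_dead_of_scale_le ht₀ hκs hκ's hκ''s hlo hdead
    rw [h1, mul_zero, zero_mul, abs_zero]; positivity
  · obtain ⟨-, hDu, hupos⟩ := farS_antidiag_alive ht₀ ht25 hlo hD he halive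
    have h1 := ppSmoothScale_pos hlo e
    have h2 := ppSmoothScale_pos hlo (D - e)
    have hr := ppSmoothRatio_mem_Ioo hlo e (D - e)
    have hk' := hκ'b _ ⟨hr.1.le, hr.2.le⟩
    have hN := abs_ppTrueNumerator_le_one hβ Λ e (D - e)
    -- `|ρ| ≤ lo²/(m̃ₑ m̃ᵤ) ≤ lo/m̃ᵤ ≤ lo/(D−e) ≤ lo/((1−t₁)D)`
    have hρ : |lo ^ 2 * (e ^ 2 - (D - e) ^ 2) / (ppSmoothScale lo e * ppSmoothScale lo (D - e) * (ppSmoothScale lo e + ppSmoothScale lo (D - e)) ^ 2)| ≤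
        lo / ((1 - t₁) * D) := by
      have hden : 0 < ppSmoothScale lo e * ppSmoothScale lo (D - e) * (ppSmoothScale lo e + ppSmoothScale lo (D - e)) ^ 2 := by positivity
      have hnum : |e ^ 2 - (D - e) ^ 2| ≤ (ppSmoothScale lo e + ppSmoothScale lo (D - e)) ^ 2 := by
        have hSe2 := ppSmoothScale_sq lo e; have hSu2 := ppSmoothScale_sq lo (D - e)
        rw [abs_le]; constructor <;> nlinarith [sq_nonneg lo, mul_pos h1 h2]
      have hle : lo ≤ ppSmoothScale lo e := le_ppSmoothScale hlo.le e
      have hue : D - e ≤ ppSmoothScale lo (D - e) := (le_abs_self _).trans (abs_le_ppSmoothScale lo (D - e))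
      rw [abs_div, abs_mul, abs_of_nonneg (sq_nonneg lo), abs_of_pos hden, div_le_div_iff₀ hden (by positivity)]
      calc lo ^ 2 * |e ^ 2 - (D - e) ^ 2| * ((1 - t₁) * D) ≤ lo ^ 2 * (ppSmoothScale lo e + ppSmoothScale lo (D - e)) ^ 2 * (D - e) := by gcongr
        _ = lo * (lo * (D - e)) * (ppSmoothScale lo e + ppSmoothScale lo (D - e)) ^ 2 := by ring
        _ ≤ lo * (ppSmoothScale lo e * ppSmoothScale lo (D - e)) * (ppSmoothScale lo e + ppSmoothScale lo (D - e)) ^ 2 := by gcongr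
        _ = lo * (ppSmoothScale lo e * ppSmoothScale lo (D - e) * (ppSmoothScale lo e + ppSmoothScale lo (D - e)) ^ 2) := by ring
    rw [abs_mul, abs_mul]
    calc |ppTrueNumerator β Λ e (D - e)| * |κ' (ppSmoothRatio lo e (D - e))| * _ ≤ 1 * κ₁ * (lo / ((1 - t₁) * D)) := by gcongr
      _ = κ₁ * (lo / ((1 - t₁) * D)) := by ring

set_option maxHeartbeats 400000 in
include hβ hΛ hB₁ hκb ht₀ ht25 hκs hκ's hκ''s hlo in
/-- **Euler-defect term, loop level NEAR the shell** (`0 < e ≤ Λ`, `2Λ ≤ D`): `|E_N·κ(r)| ≤ κ₀·((6B₁+5/2) + β|D−e|e^{−β|D−e|} + Λ/((1−t₁)D))`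
(alive ⟹ partner `D−e ≥ (1−t₁)D > Λ` beyond the shell: `|∂ᵤN| ≤ (β/4)sech² + Λ/u²`; loop level by the uniform gradient). [cite: BenfattoGiulianiMastropietro2006, §2.4 (2.36)] -/
theorem abs_farEuler_near_le {D e : ℝ} (hD : 2 * Λ ≤ D) (he : 0 < e) (heΛ : e ≤ Λ) :
    |(e * ppTrueNumeratorDu β Λ (D - e) e + (D - e) * ppTrueNumeratorDu β Λ e (D - e)) * κ (ppSmoothRatio lo e (D - e))| ≤
      κ₀ * ((6 * B₁ + 5 / 2) + β * |D - e| * Real.exp (-(β * |D - e|)) + Λ / ((1 - t₁) * D)) := by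
  have hB0 := salmhoferB₁_nonneg hB₁
  have hκ₀ : 0 ≤ κ₀ := (abs_nonneg _).trans (hκb 0 (left_mem_Icc.2 zero_le_one))
  have hD0 : 0 < D := by linarith
  have ht1 : 0 < 1 - t₁ := by linarith
  rcases le_or_gt (ppSmoothScale lo (D - e)) ((1 - t₁) / t₁ * ppSmoothScale lo e) with hdead | halive
  · obtain ⟨h0, -, -⟩ := farS_dead_of_scale_le ht₀ hκs hκ's hκ''s hlo hdead
    rw [h0, mul_zero, abs_zero]; positivity
  · obtain ⟨-, hDu, hupos⟩ := farS_antidiag_alive ht₀ ht25 hlo hD0 he halive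
    have hufar : Λ < |D - e| := by rw [abs_of_pos hupos]; nlinarith
    have hr := ppSmoothRatio_mem_Ioo hlo e (D - e)
    have hk := hκb _ ⟨hr.1.le, hr.2.le⟩
    -- loop term: uniform gradient, `e ≤ Λ`
    have h1 : |e * ppTrueNumeratorDu β Λ (D - e) e| ≤ 6 * B₁ + 5 / 2 := by
      rw [abs_mul, abs_of_pos he]
      calc e * |ppTrueNumeratorDu β Λ (D - e) e| ≤ Λ * ((6 * B₁ + 5 / 2) / Λ) := mul_le_mul heΛ (abs_ppTrueNumeratorDu_le_unif hβ hΛ hB₁ _ _) (abs_nonneg _) hΛ.le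
        _ = 6 * B₁ + 5 / 2 := by field_simp
    -- partner term: far partner, thermal + shell tail
    have h2 : |(D - e) * ppTrueNumeratorDu β Λ e (D - e)| ≤ β * |D - e| * Real.exp (-(β * |D - e|)) + Λ / ((1 - t₁) * D) := by
      have hb := abs_ppTrueNumeratorDu_far_le_abs hβ hΛ hufar e
      rw [abs_mul]
      have hu0 : 0 < |D - e| := hΛ.trans hufar
      calc |D - e| * |ppTrueNumeratorDu β Λ e (D - e)| ≤ |D - e| * (β / 4 * sech (β * (D - e) / 2) ^ 2 + Λ / (D - e) ^ 2) := by gcongr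
        _ = |(D - e) * (β / 4 * sech (β * (D - e) / 2) ^ 2)| + Λ / |D - e| := by
            rw [mul_add, abs_mul, abs_of_nonneg (by positivity : (0 : ℝ) ≤ β / 4 * sech (β * (D - e) / 2) ^ 2), ← sq_abs (D - e)]
            field_simp
        _ ≤ β * |D - e| * Real.exp (-(β * |D - e|)) + Λ / ((1 - t₁) * D) := by
            refine add_le_add (abs_mul_sech_sq_le hβ _) ?_
            rw [abs_of_pos hupos]
            exact div_le_div_of_nonneg_left hΛ.le (by positivity) hDu
    rw [abs_mul]
    calc |e * ppTrueNumeratorDu β Λ (D - e) e + (D - e) * ppTrueNumeratorDu β Λ e (D - e)| * |κ (ppSmoothRatio lo e (D - e))|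
        ≤ ((6 * B₁ + 5 / 2) + (β * |D - e| * Real.exp (-(β * |D - e|)) + Λ / ((1 - t₁) * D))) * κ₀ :=
          mul_le_mul ((abs_add_le _ _).trans (add_le_add h1 h2)) hk (abs_nonneg _) (by positivity)
      _ = _ := by ring

set_option maxHeartbeats 400000 in
include hβ hΛ hB₁ hκb ht₀ ht25 hκs hκ's hκ''s hlo in
/-- **Euler-defect term, loop level FAR** (`Λ < e`, `2Λ ≤ D`): `|E_N·κ(r)| ≤ κ₀·(βe·e^{−βe} + β|D−e|e^{−β|D−e|})` (alive ⟹ both lines beyond the shell, exact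
thermal forms). [cite: BenfattoGiulianiMastropietro2006, §2.1 (2.2)-(2.5)] -/
theorem abs_farEuler_far_le {D e : ℝ} (hD : 2 * Λ ≤ D) (he : Λ < e) :
    |(e * ppTrueNumeratorDu β Λ (D - e) e + (D - e) * ppTrueNumeratorDu β Λ e (D - e)) * κ (ppSmoothRatio lo e (D - e))| ≤
      κ₀ * (β * e * Real.exp (-(β * e)) + β * |D - e| * Real.exp (-(β * |D - e|))) := by
  have hκ₀ : 0 ≤ κ₀ := (abs_nonneg _).trans (hκb 0 (left_mem_Icc.2 zero_le_one))
  have he0 : 0 < e := hΛ.trans he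
  have hD0 : 0 < D := by linarith
  rcases le_or_gt (ppSmoothScale lo (D - e)) ((1 - t₁) / t₁ * ppSmoothScale lo e) with hdead | halive
  · obtain ⟨h0, -, -⟩ := farS_dead_of_scale_le ht₀ hκs hκ's hκ''s hlo hdead
    rw [h0, mul_zero, abs_zero]; positivity
  · obtain ⟨-, hDu, hupos⟩ := farS_antidiag_alive ht₀ ht25 hlo hD0 he0 halive
    have hufar : Λ < |D - e| := by rw [abs_of_pos hupos]; nlinarith
    obtain ⟨hf1, hf2⟩ := ppTrueNumeratorDu_antidiag_far hβ hΛ hB₁ he hufar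
    have hr := ppSmoothRatio_mem_Ioo hlo e (D - e)
    have hk := hκb _ ⟨hr.1.le, hr.2.le⟩
    have h1 : |e * ppTrueNumeratorDu β Λ (D - e) e| ≤ β * e * Real.exp (-(β * e)) := by
      rw [hf1]; have := abs_mul_sech_sq_le hβ e; rwa [abs_of_pos he0] at this
    have h2 : |(D - e) * ppTrueNumeratorDu β Λ e (D - e)| ≤ β * |D - e| * Real.exp (-(β * |D - e|)) := by rw [hf2]; exact abs_mul_sech_sq_le hβ _
    rw [abs_mul]
    calc _ ≤ (β * e * Real.exp (-(β * e)) + β * |D - e| * Real.exp (-(β * |D - e|))) * κ₀ :=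
          mul_le_mul ((abs_add_le _ _).trans (add_le_add h1 h2)) hk (abs_nonneg _) (by positivity)
      _ = _ := by ring

end Flat

end Summit.HubbardSuperconductivity.HubbardSuperconductivity.Theorems.C4a

end
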